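import Literature.AlgebraicGeometry.Motives.AbelianVarietyPermutationPowerCharacter
import Literature.AlgebraicGeometry.Motives.AbelianVarietyCharacterSupportRanks
import HarnessLib

/-!
# Frobenius reciprocity for permutation powers: `Hom_G(X, A^{G/H}) ≅ Hom(X, A)^H` and `Hom_G(A^{G/H}, Y) ≅ Hom(A, Y)^H`,
# with the bounds `rk_ℤ Hom_G(X, A^{G/H}) ≤ 4 · dim B_H(X) · dim A`, `rk_ℤ Hom_G(A^{G/H}, Y) ≤ 4 · dim A · dim B_H(Y)`

Let `G` act TRANSITIVELY on a finite set `T`, let `t₀ ∈ T` have stabiliser `H` (so `T ≅ G/H`), and let `A^T` be the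
permutation power of an abelian variety `A` over a field `K` (a bicone `b` with `Σ_t π_t ≫ ι_t = 𝟙` and an action `ρ` with
`ι_t ≫ ρ(g) = ι_{g t}`, `Motives/AbelianVarietyPermutationPowerHom`).  Then `A^T = A ⊗ ℤ[G/H]` is the abelian variety
INDUCED (equivalently, co-induced: `[G : H] < ∞`) from `A` with the trivial `H`-action, and Frobenius reciprocity
(Serre §7.2 Thm. 13 and Remark (1): "`Res` and `Ind` are adjoints of each other"; §3.3 Ex. 2: the permutation representation on
`G/H` is `Ind_H^G 1`) holds on the nose for homomorphisms of abelian varieties: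

* §2 (maps INTO the power) for any action `ρ' : G → End X`, **`f ↦ f ≫ π_{t₀}` is an additive bijection
  `Hom_G(X, A^T) ≅ Hom(X, A)^H = {u : X → A | ρ'(h) ≫ u = u ∀ h ∈ H}`** with inverse `u ↦ Σ_t (ρ'(g_t⁻¹) ≫ u) ≫ ι_t`
  (`g_t t₀ = t`; independent of the choice because `H` fixes `u`): `finrank_equivariantHom_permPower_target_eq`
  **`rk_ℤ Hom_G(X, A^T) = rk_ℤ Hom(X, A)^H`**, and with the bound of `Motives/AbelianVarietyInvariantHomRank`
  (`rk Hom(X, A)^H ≤ 4 dim B_H(X) dim A`, `B_H(X) = Im Σ_{h ∈ H} ρ'(h)`)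
  **`rk_ℤ Hom_G(X, A^{G/H}) ≤ 4 · dim B_H(X) · dim A`** (`finrank_equivariantHom_permPower_target_le_four_mul`):
  equivariant maps into the induced power factor through the `H`-coinvariant quotient `X → X/H ∼ B_H(X)`;
* §3 (maps OUT OF the power) for any action `ρ_Y : G → End Y`, **`f ↦ ι_{t₀} ≫ f` is an additive bijection
  `Hom_G(A^T, Y) ≅ {v : A → Y | v ≫ ρ_Y(h) = v ∀ h ∈ H}`** with inverse `v ↦ Σ_t π_t ≫ v ≫ ρ_Y(g_t)`:
  **`rk_ℤ Hom_G(A^T, Y) = rk_ℤ {v | v ≫ ρ_Y(h) = v}`** (`finrank_equivariantHom_permPower_source_eq`) and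
  **`rk_ℤ Hom_G(A^{G/H}, Y) ≤ 4 · dim A · dim B_H(Y)`** (`finrank_equivariantHom_permPower_source_le_four_mul`);
* §4 the coset space itself: `T = G/H`, `t₀ = 1·H`, `Stab(t₀) = H` (Mathlib `MulAction.stabilizer_quotient`):
  `finrank_equivariantHom_cosetPower_target_eq`, `finrank_equivariantHom_cosetPower_source_eq`.

§1 collects the action identities `ρ(ab) = ρ(b) ≫ ρ(a)`, `ρ(g⁻¹) ≫ ρ(g) = 𝟙` (composition in `End X` is reversed) and the
independence-of-representative lemmas.  Everything is a theorem (no definitions); `G` need not be finite except where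
`B_H` (a sum over `H`) enters, and there only `H` is assumed finite.

## References

* [SerreLinearRepresentations1977] J.-P. Serre, *Linear Representations of Finite Groups*, GTM 42 (1977): §3.3 (induced
  representations; Ex. 2: `V` with basis `(e_σ)_{σ ∈ G/H}`, `ρ_s e_σ = e_{sσ}`, is induced from the unit representation of `H`),
  §7.2 Thm. 13 (Frobenius reciprocity `⟨ψ, Res φ⟩_H = ⟨Ind ψ, φ⟩_G`) and Remark (1) (`Res` and `Ind` are adjoint), Ex. 7.2.
  Held: `book:serre1977-linear-representations-finite-groups`, pp. 30, 51–52 read.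
* [JordanEtAl2018] B. W. Jordan et al., *Abelian varieties isogenous to a power of an elliptic curve*, Compos. Math. 154 (2018),
  §4.1: `Hom(C, 𝓗𝓞𝓜_R(M, E)) ≅ Hom_R(M, Hom(C, E))` — here `R = ℤ[G]`, `M = ℤ[G/H]`, `Hom_{ℤ[G]}(ℤ[G/H], V) = V^H`.
* [MumfordAV1970] D. Mumford, *Abelian Varieties* (1970), §19 Thm. 3 and Cor. 1 (pp. 176–178).
* [KaniRosen1989] E. Kani, M. Rosen, *Idempotent relations and factors of Jacobians*, Math. Ann. 284 (1989), §3 Thm. B.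
* [LangeRodriguez2022] H. Lange, R. E. Rodríguez, *Decomposition of Jacobians by Prym Varieties*, LNM 2310 (2022), §2.9.1
  Prop. 2.9.3 (PDF p. 46).
-/

noncomputable section

open CategoryTheory CategoryTheory.Limits
open Literature.NumberTheory.DiophantineGeometry

universe u

namespace Literature.AlgebraicGeometry.Motives

namespace AbelianVariety

variable {K : Type u} [Field K]

/-! ## §1 Action identities and independence of the coset representative -/

section ActionIdentities

variable {X : AbelianVariety K} {G : Type} [Group G] (ρ : G →* End X)

/-- `ρ(a b) = ρ(b) ≫ ρ(a)` as morphisms (multiplication in `End X` is composition in the reverse order).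
[cite: SerreLinearRepresentations1977, §1.1 (`ρ(st) = ρ(s)ρ(t)`)] -/
theorem asHom_map_mul_eq_comp (a b : G) : End.asHom (ρ (a * b)) = End.asHom (ρ b) ≫ End.asHom (ρ a) := by
  rw [map_mul]
  rfl

/-- `ρ(1) = 𝟙`. [cite: SerreLinearRepresentations1977, §1.1] -/
theorem asHom_map_one_eq_id : End.asHom (ρ 1) = 𝟙 X := by
  rw [map_one]
  rfl

/-- `ρ(g⁻¹) ≫ ρ(g) = 𝟙`. [cite: SerreLinearRepresentations1977, §1.1 (`ρ(s⁻¹) = ρ(s)⁻¹`)] -/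
theorem asHom_inv_comp_asHom (g : G) : End.asHom (ρ g⁻¹) ≫ End.asHom (ρ g) = 𝟙 X := by
  rw [← asHom_map_mul_eq_comp, mul_inv_cancel, asHom_map_one_eq_id]

/-- `ρ(g) ≫ ρ(g⁻¹) = 𝟙`. [cite: SerreLinearRepresentations1977, §1.1] -/
theorem asHom_comp_asHom_inv (g : G) : End.asHom (ρ g) ≫ End.asHom (ρ g⁻¹) = 𝟙 X := by
  rw [← asHom_map_mul_eq_comp, inv_mul_cancel, asHom_map_one_eq_id]

variable {T : Type} [MulAction G T] (t₀ : T)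

/-- **Independence of the representative, source side**: if `ρ(h) ≫ u = u` for all `h` in the stabiliser of `t₀` and
`x t₀ = y t₀`, then `ρ(x⁻¹) ≫ u = ρ(y⁻¹) ≫ u` (`x⁻¹ = (x⁻¹ y) y⁻¹` with `x⁻¹ y ∈ Stab(t₀)`).
[cite: SerreLinearRepresentations1977, §3.3 (definition of the induced representation: `W_σ = ρ_s W` does not depend on `s ∈ σ`)] -/
theorem asHom_inv_comp_eq_of_smul_eq {Y : AbelianVariety K} {u : X ⟶ Y}
    (hu : ∀ h : MulAction.stabilizer G t₀, End.asHom (ρ h) ≫ u = u) {x y : G} (hxy : x • t₀ = y • t₀) :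
    End.asHom (ρ x⁻¹) ≫ u = End.asHom (ρ y⁻¹) ≫ u := by
  have hk : x⁻¹ * y ∈ MulAction.stabilizer G t₀ := by
    rw [MulAction.mem_stabilizer_iff, mul_smul, ← hxy, inv_smul_smul]
  conv_lhs => rw [← mul_inv_cancel_right x⁻¹ y, asHom_map_mul_eq_comp, Category.assoc, hu ⟨x⁻¹ * y, hk⟩]

/-- **Independence of the representative, target side**: if `v ≫ ρ(h) = v` for all `h ∈ Stab(t₀)` and `x t₀ = y t₀`, then
`v ≫ ρ(x) = v ≫ ρ(y)` (`x = y (y⁻¹ x)` with `y⁻¹ x ∈ Stab(t₀)`). [cite: SerreLinearRepresentations1977, §3.3] -/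
theorem comp_asHom_eq_of_smul_eq {A : AbelianVariety K} {v : A ⟶ X}
    (hv : ∀ h : MulAction.stabilizer G t₀, v ≫ End.asHom (ρ h) = v) {x y : G} (hxy : x • t₀ = y • t₀) :
    v ≫ End.asHom (ρ x) = v ≫ End.asHom (ρ y) := by
  have hk : y⁻¹ * x ∈ MulAction.stabilizer G t₀ := by
    rw [MulAction.mem_stabilizer_iff, mul_smul, hxy, inv_smul_smul]
  conv_lhs => rw [← mul_inv_cancel_left y x, asHom_map_mul_eq_comp, ← Category.assoc, hv ⟨y⁻¹ * x, hk⟩]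

end ActionIdentities

/-! ## §2 Maps INTO the power: `Hom_G(X, A^T) ≅ Hom(X, A)^{Stab(t₀)}`, `f ↦ f ≫ π_{t₀}` -/

section Target

variable {A X : AbelianVariety K} {T : Type} [Fintype T] (b : Bicone (fun _ : T ↦ A))
  {G : Type} [Group G] [MulAction G T] (ρ : G →* End b.pt) (ρ' : G →* End X) (t₀ : T)

/-- The `t₀`-component of an equivariant map into a permutation power is fixed by the stabiliser:
`ρ'(h) ≫ (f ≫ π_{t₀}) = f ≫ π_{t₀}` for `h t₀ = t₀`. [cite: SerreLinearRepresentations1977, §7.2 Thm. 13 and Remark (1)] -/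
theorem asHom_comp_comp_π_eq_of_mem_stabilizer (hb : ∑ t, b.π t ≫ b.ι t = 𝟙 b.pt)
    (hρ : ∀ (g : G) (t : T), b.ι t ≫ End.asHom (ρ g) = b.ι (g • t)) {f : X ⟶ b.pt}
    (hf : ∀ g : G, End.asHom (ρ' g) ≫ f = f ≫ End.asHom (ρ g)) (h : MulAction.stabilizer G t₀) :
    End.asHom (ρ' h) ≫ f ≫ b.π t₀ = f ≫ b.π t₀ := by
  have := (permPower_comm_iff_target b ρ ρ' hb hρ f).1 hf (h : G) t₀
  rwa [show (h : G) • t₀ = t₀ from MulAction.mem_stabilizer_iff.1 h.2] at this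

/-- **Frobenius reciprocity, maps into the induced power: `rk_ℤ Hom_G(X, A^T) = rk_ℤ Hom(X, A)^{Stab(t₀)}`** for a
TRANSITIVE `G`-set `T ∋ t₀` (`T ≅ G/H`, `H = Stab(t₀)`, `A^T = Ind_H^G A` with the trivial `H`-action on `A`): the additive
bijection is `f ↦ f ≫ π_{t₀}` with inverse `u ↦ Σ_t (ρ'(g_t⁻¹) ≫ u) ≫ ι_t`, `g_t t₀ = t` — "`Hom_G(V, Ind W) = Hom_H(Res V, W)`",
`Hom_{ℤ[G]}(ℤ[G/H], Hom(X, A)) = Hom(X, A)^H`. [cite: SerreLinearRepresentations1977, §7.2 Thm. 13 and Remark (1); §3.3 Ex. 2]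
[cite: JordanEtAl2018, §4.1 (`Hom(C, 𝓗𝓞𝓜_R(M, E)) ≅ Hom_R(M, Hom(C, E))`)] [cite: MumfordAV1970, §19 Thm. 3 (p. 176)] -/
theorem finrank_equivariantHom_permPower_target_eq [MulAction.IsPretransitive G T] (hb : ∑ t, b.π t ≫ b.ι t = 𝟙 b.pt)
    (hρ : ∀ (g : G) (t : T), b.ι t ≫ End.asHom (ρ g) = b.ι (g • t)) :
    Module.finrank ℤ (⨅ g : G, LinearMap.eqLocus (Preadditive.leftComp b.pt (End.asHom (ρ' g))).toIntLinearMap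
        (Preadditive.rightComp X (End.asHom (ρ g))).toIntLinearMap : Submodule ℤ (X ⟶ b.pt)) =
      Module.finrank ℤ (⨅ h : MulAction.stabilizer G t₀,
        LinearMap.eqLocus (Preadditive.leftComp A (End.asHom (ρ' h))).toIntLinearMap LinearMap.id : Submodule ℤ (X ⟶ A)) := by
  set V := (⨅ g : G, LinearMap.eqLocus (Preadditive.leftComp b.pt (End.asHom (ρ' g))).toIntLinearMap
    (Preadditive.rightComp X (End.asHom (ρ g))).toIntLinearMap : Submodule ℤ (X ⟶ b.pt)) with hV
  set W := (⨅ h : MulAction.stabilizer G t₀,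
    LinearMap.eqLocus (Preadditive.leftComp A (End.asHom (ρ' h))).toIntLinearMap LinearMap.id : Submodule ℤ (X ⟶ A)) with hW
  have memV := fun f ↦ mem_iInf_eqLocus_leftComp_rightComp_iff ρ' ρ f
  have memW : ∀ u : X ⟶ A, u ∈ W ↔ ∀ h : MulAction.stabilizer G t₀, End.asHom (ρ' h) ≫ u = u := fun u ↦ by
    rw [hW]
    simp only [Submodule.mem_iInf, LinearMap.mem_eqLocus]
    exact Iff.rfl
  have crit := fun f ↦ permPower_comm_iff_target b ρ ρ' hb hρ f
  -- coset representatives `τ t • t₀ = t`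
  let τ : T → G := fun t ↦ (MulAction.exists_smul_eq G t₀ t).choose
  have hτ : ∀ t, τ t • t₀ = t := fun t ↦ (MulAction.exists_smul_eq G t₀ t).choose_spec
  let e : V ≃+ W :=
    { toFun := fun f ↦ ⟨(f : X ⟶ b.pt) ≫ b.π t₀, (memW _).2 fun h ↦
          asHom_comp_comp_π_eq_of_mem_stabilizer b ρ ρ' t₀ hb hρ ((memV _).1 f.2) h⟩
      invFun := fun u ↦ ⟨∑ t, (End.asHom (ρ' (τ t)⁻¹) ≫ (u : X ⟶ A)) ≫ b.ι t, (memV _).2 ((crit _).2 fun g t ↦ by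
          rw [sum_comp_ι_comp_π b _ (g • t), sum_comp_ι_comp_π b _ t,
            asHom_inv_comp_eq_of_smul_eq ρ' t₀ ((memW _).1 u.2) (show τ (g • t) • t₀ = (g * τ t) • t₀ by
              rw [hτ, mul_smul, hτ]),
            mul_inv_rev, asHom_map_mul_eq_comp, ← Category.assoc, ← Category.assoc, asHom_comp_asHom_inv,
            Category.id_comp])⟩
      left_inv := fun f ↦ Subtype.ext (by
          change (∑ t, (End.asHom (ρ' (τ t)⁻¹) ≫ (f : X ⟶ b.pt) ≫ b.π t₀) ≫ b.ι t) = (f : X ⟶ b.pt)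
          refine hom_ext_π b hb fun t ↦ ?_
          rw [sum_comp_ι_comp_π b _ t]
          have := (crit _).1 ((memV _).1 f.2) (τ t)⁻¹ t
          rwa [show (τ t)⁻¹ • t = t₀ from inv_smul_eq_iff.2 (hτ t).symm] at this)
      right_inv := fun u ↦ Subtype.ext (by
          change (∑ t, (End.asHom (ρ' (τ t)⁻¹) ≫ (u : X ⟶ A)) ≫ b.ι t) ≫ b.π t₀ = (u : X ⟶ A)
          rw [sum_comp_ι_comp_π b _ t₀,
            asHom_inv_comp_eq_of_smul_eq ρ' t₀ ((memW _).1 u.2) (show τ t₀ • t₀ = (1 : G) • t₀ by rw [hτ, one_smul]),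
            inv_one, asHom_map_one_eq_id, Category.id_comp])
      map_add' := fun f f' ↦ Subtype.ext (by
          change ((f : X ⟶ b.pt) + (f' : X ⟶ b.pt)) ≫ b.π t₀ = (f : X ⟶ b.pt) ≫ b.π t₀ + (f' : X ⟶ b.pt) ≫ b.π t₀
          rw [Preadditive.add_comp]) }
  convert e.toIntLinearEquiv.finrank_eq using 2

/-- **`rk_ℤ Hom_G(X, A^{G/H}) ≤ 4 · dim B_H(X) · dim A`**: for a transitive `G`-set `T ∋ t₀` with FINITE stabiliser `H`, any action
`ρ'` of `G` on `X` with `N_H = Σ_{h ∈ H} ρ'(h)`, `B_H(X) = Im N_H`, the equivariant homomorphisms `X → A^T` are the `H`-invariant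
homomorphisms `X → A` (Frobenius reciprocity), which are at most as numerous as homomorphisms out of `X/H ∼ B_H(X)`
(`Motives/AbelianVarietyInvariantHomRank`, Mumford §19 Cor. 1 refined). [cite: SerreLinearRepresentations1977, §7.2 Thm. 13]
[cite: MumfordAV1970, §19 Thm. 3 and Cor. 1 (pp. 176–178)] [cite: KaniRosen1989, §3 Thm. B] [cite: LangeRodriguez2022, §2.9.1 Prop. 2.9.3 (PDF p. 46)] -/
theorem finrank_equivariantHom_permPower_target_le_four_mul [MulAction.IsPretransitive G T]
    (hb : ∑ t, b.π t ≫ b.ι t = 𝟙 b.pt) (hρ : ∀ (g : G) (t : T), b.ι t ≫ End.asHom (ρ g) = b.ι (g • t))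
    {H : Subgroup G} [Fintype H] (hH : MulAction.stabilizer G t₀ = H) {N : X ⟶ X} (hN : End.of N = ∑ h : H, ρ' h) :
    Module.finrank ℤ (⨅ g : G, LinearMap.eqLocus (Preadditive.leftComp b.pt (End.asHom (ρ' g))).toIntLinearMap
        (Preadditive.rightComp X (End.asHom (ρ g))).toIntLinearMap : Submodule ℤ (X ⟶ b.pt)) ≤
      4 * (image N).dim * A.dim := by
  subst hH
  rw [finrank_equivariantHom_permPower_target_eq b ρ ρ' t₀ hb hρ]
  exact finrank_hom_source_invariant_le_four_mul' (ρ'.comp (MulAction.stabilizer G t₀).subtype) hN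

end Target

/-! ## §3 Maps OUT OF the power: `Hom_G(A^T, Y) ≅ {v : A → Y | v ≫ ρ_Y(h) = v ∀ h ∈ Stab(t₀)}`, `f ↦ ι_{t₀} ≫ f` -/

section Source

variable {A Y : AbelianVariety K} {T : Type} [Fintype T] (b : Bicone (fun _ : T ↦ A))
  {G : Type} [Group G] [MulAction G T] (ρ : G →* End b.pt) (ρY : G →* End Y) (t₀ : T)

/-- The `t₀`-component of an equivariant map out of a permutation power is fixed by the stabiliser on the right:
`(ι_{t₀} ≫ f) ≫ ρ_Y(h) = ι_{t₀} ≫ f` for `h t₀ = t₀`. [cite: SerreLinearRepresentations1977, §7.2 Thm. 13 and Remark (1)] -/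
theorem ι_comp_comp_asHom_eq_of_mem_stabilizer (hb : ∑ t, b.π t ≫ b.ι t = 𝟙 b.pt)
    (hρ : ∀ (g : G) (t : T), b.ι t ≫ End.asHom (ρ g) = b.ι (g • t)) {f : b.pt ⟶ Y}
    (hf : ∀ g : G, End.asHom (ρ g) ≫ f = f ≫ End.asHom (ρY g)) (h : MulAction.stabilizer G t₀) :
    (b.ι t₀ ≫ f) ≫ End.asHom (ρY h) = b.ι t₀ ≫ f := by
  have := (permPower_comm_iff_source b ρ ρY hb hρ f).1 hf (h : G) t₀
  rw [show (h : G) • t₀ = t₀ from MulAction.mem_stabilizer_iff.1 h.2] at this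
  exact this.symm

/-- **Frobenius reciprocity, maps out of the induced power: `rk_ℤ Hom_G(A^T, Y) = rk_ℤ {v : A → Y | v ≫ ρ_Y(h) = v ∀ h ∈ Stab(t₀)}`**
for a TRANSITIVE `G`-set `T ∋ t₀`: the additive bijection is `f ↦ ι_{t₀} ≫ f` with inverse `v ↦ Σ_t π_t ≫ v ≫ ρ_Y(g_t)`
(`g_t t₀ = t`) — "`Hom_G(Ind W, V) = Hom_H(W, Res V)`" for `W = A` with the trivial `H`-action.
[cite: SerreLinearRepresentations1977, §7.2 Thm. 13 and Remark (1); §3.3 Ex. 2] [cite: JordanEtAl2018, §4.1 and Remark 4.1 (copower `M ⊗_R E`)]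
[cite: MumfordAV1970, §19 Thm. 3 (p. 176)] -/
theorem finrank_equivariantHom_permPower_source_eq [MulAction.IsPretransitive G T] (hb : ∑ t, b.π t ≫ b.ι t = 𝟙 b.pt)
    (hρ : ∀ (g : G) (t : T), b.ι t ≫ End.asHom (ρ g) = b.ι (g • t)) :
    Module.finrank ℤ (⨅ g : G, LinearMap.eqLocus (Preadditive.leftComp Y (End.asHom (ρ g))).toIntLinearMap
        (Preadditive.rightComp b.pt (End.asHom (ρY g))).toIntLinearMap : Submodule ℤ (b.pt ⟶ Y)) =
      Module.finrank ℤ (⨅ h : MulAction.stabilizer G t₀,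
        LinearMap.eqLocus (Preadditive.rightComp A (End.asHom (ρY h))).toIntLinearMap LinearMap.id : Submodule ℤ (A ⟶ Y)) := by
  set V := (⨅ g : G, LinearMap.eqLocus (Preadditive.leftComp Y (End.asHom (ρ g))).toIntLinearMap
    (Preadditive.rightComp b.pt (End.asHom (ρY g))).toIntLinearMap : Submodule ℤ (b.pt ⟶ Y)) with hV
  set W := (⨅ h : MulAction.stabilizer G t₀,
    LinearMap.eqLocus (Preadditive.rightComp A (End.asHom (ρY h))).toIntLinearMap LinearMap.id : Submodule ℤ (A ⟶ Y)) with hW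
  have memV := fun f ↦ mem_iInf_eqLocus_leftComp_rightComp_iff ρ ρY f
  have memW : ∀ v : A ⟶ Y, v ∈ W ↔ ∀ h : MulAction.stabilizer G t₀, v ≫ End.asHom (ρY h) = v := fun v ↦ by
    rw [hW]
    simp only [Submodule.mem_iInf, LinearMap.mem_eqLocus]
    exact Iff.rfl
  have crit := fun f ↦ permPower_comm_iff_source b ρ ρY hb hρ f
  let τ : T → G := fun t ↦ (MulAction.exists_smul_eq G t₀ t).choose
  have hτ : ∀ t, τ t • t₀ = t := fun t ↦ (MulAction.exists_smul_eq G t₀ t).choose_spec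
  let e : V ≃+ W :=
    { toFun := fun f ↦ ⟨b.ι t₀ ≫ (f : b.pt ⟶ Y), (memW _).2 fun h ↦
          ι_comp_comp_asHom_eq_of_mem_stabilizer b ρ ρY t₀ hb hρ ((memV _).1 f.2) h⟩
      invFun := fun v ↦ ⟨∑ t, b.π t ≫ (v : A ⟶ Y) ≫ End.asHom (ρY (τ t)), (memV _).2 ((crit _).2 fun g s ↦ by
          rw [ι_comp_sum_π_comp b _ (g • s), ι_comp_sum_π_comp b _ s, Category.assoc,
            comp_asHom_eq_of_smul_eq ρY t₀ ((memW _).1 v.2) (show τ (g • s) • t₀ = (g * τ s) • t₀ by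
              rw [hτ, mul_smul, hτ]),
            asHom_map_mul_eq_comp])⟩
      left_inv := fun f ↦ Subtype.ext (by
          change (∑ t, b.π t ≫ (b.ι t₀ ≫ (f : b.pt ⟶ Y)) ≫ End.asHom (ρY (τ t))) = (f : b.pt ⟶ Y)
          refine hom_ext_ι b hb fun t ↦ ?_
          rw [ι_comp_sum_π_comp b _ t]
          have := (crit _).1 ((memV _).1 f.2) (τ t) t₀
          rw [hτ] at this
          exact this.symm)
      right_inv := fun v ↦ Subtype.ext (by
          change b.ι t₀ ≫ (∑ t, b.π t ≫ (v : A ⟶ Y) ≫ End.asHom (ρY (τ t))) = (v : A ⟶ Y)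
          rw [ι_comp_sum_π_comp b _ t₀,
            comp_asHom_eq_of_smul_eq ρY t₀ ((memW _).1 v.2) (show τ t₀ • t₀ = (1 : G) • t₀ by rw [hτ, one_smul]),
            asHom_map_one_eq_id, Category.comp_id])
      map_add' := fun f f' ↦ Subtype.ext (by
          change b.ι t₀ ≫ ((f : b.pt ⟶ Y) + (f' : b.pt ⟶ Y)) = b.ι t₀ ≫ (f : b.pt ⟶ Y) + b.ι t₀ ≫ (f' : b.pt ⟶ Y)
          rw [Preadditive.comp_add]) }
  convert e.toIntLinearEquiv.finrank_eq using 2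

/-- **`rk_ℤ Hom_G(A^{G/H}, Y) ≤ 4 · dim A · dim B_H(Y)`**: for a transitive `G`-set `T ∋ t₀` with FINITE stabiliser `H`, any
action `ρ_Y` of `G` on `Y` with `N_H = Σ_{h ∈ H} ρ_Y(h)`, `B_H(Y) = Im N_H`, the equivariant homomorphisms `A^T → Y` are the
homomorphisms `A → Y` with image fixed by `H`, at most as numerous as the homomorphisms `A → B_H(Y)`.
[cite: SerreLinearRepresentations1977, §7.2 Thm. 13] [cite: MumfordAV1970, §19 Thm. 3 and Cor. 1 (pp. 176–178)]
[cite: KaniRosen1989, §3 Thm. B] [cite: LangeRodriguez2022, §2.9.1 Prop. 2.9.3 (PDF p. 46)] -/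
theorem finrank_equivariantHom_permPower_source_le_four_mul [MulAction.IsPretransitive G T]
    (hb : ∑ t, b.π t ≫ b.ι t = 𝟙 b.pt) (hρ : ∀ (g : G) (t : T), b.ι t ≫ End.asHom (ρ g) = b.ι (g • t))
    {H : Subgroup G} [Fintype H] (hH : MulAction.stabilizer G t₀ = H) {N : Y ⟶ Y} (hN : End.of N = ∑ h : H, ρY h) :
    Module.finrank ℤ (⨅ g : G, LinearMap.eqLocus (Preadditive.leftComp Y (End.asHom (ρ g))).toIntLinearMap
        (Preadditive.rightComp b.pt (End.asHom (ρY g))).toIntLinearMap : Submodule ℤ (b.pt ⟶ Y)) ≤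
      4 * A.dim * (image N).dim := by
  subst hH
  rw [finrank_equivariantHom_permPower_source_eq b ρ ρY t₀ hb hρ]
  exact finrank_hom_target_invariant_le_four_mul' (ρY.comp (MulAction.stabilizer G t₀).subtype) hN

end Source

/-! ## §4 The coset power `A^{G/H}`: `Stab(1·H) = H` -/

section Coset

variable {A X Y : AbelianVariety K} {G : Type} [Group G] (H : Subgroup G) [Fintype (G ⧸ H)]
  (b : Bicone (fun _ : G ⧸ H ↦ A)) (ρ : G →* End b.pt) (ρ' : G →* End X) (ρY : G →* End Y)

/-- **`rk_ℤ Hom_G(X, A^{G/H}) = rk_ℤ Hom(X, A)^H`** for the coset power (`G` acts on `G/H` by left translation, `ι_{xH} ≫ ρ(g) =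
ι_{gxH}`): Frobenius reciprocity `Hom_G(V, Ind_H^G A) = Hom_H(Res V, A)` with the trivial action of `H` on `A`.
[cite: SerreLinearRepresentations1977, §7.2 Thm. 13 and §3.3 Ex. 2] [cite: JordanEtAl2018, §4.1] -/
theorem finrank_equivariantHom_cosetPower_target_eq (hb : ∑ t, b.π t ≫ b.ι t = 𝟙 b.pt)
    (hρ : ∀ (g : G) (t : G ⧸ H), b.ι t ≫ End.asHom (ρ g) = b.ι (g • t)) :
    Module.finrank ℤ (⨅ g : G, LinearMap.eqLocus (Preadditive.leftComp b.pt (End.asHom (ρ' g))).toIntLinearMap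
        (Preadditive.rightComp X (End.asHom (ρ g))).toIntLinearMap : Submodule ℤ (X ⟶ b.pt)) =
      Module.finrank ℤ (⨅ h : H,
        LinearMap.eqLocus (Preadditive.leftComp A (End.asHom (ρ' h))).toIntLinearMap LinearMap.id : Submodule ℤ (X ⟶ A)) := by
  rw [finrank_equivariantHom_permPower_target_eq b ρ ρ' ((1 : G) : G ⧸ H) hb hρ, MulAction.stabilizer_quotient H]

/-- **`rk_ℤ Hom_G(A^{G/H}, Y) = rk_ℤ {v : A → Y | v ≫ ρ_Y(h) = v ∀ h ∈ H}`** for the coset power: Frobenius reciprocity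
`Hom_G(Ind_H^G A, V) = Hom_H(A, Res V)`. [cite: SerreLinearRepresentations1977, §7.2 Thm. 13 and §3.3 Ex. 2] [cite: JordanEtAl2018, §4.1 and Remark 4.1] -/
theorem finrank_equivariantHom_cosetPower_source_eq (hb : ∑ t, b.π t ≫ b.ι t = 𝟙 b.pt)
    (hρ : ∀ (g : G) (t : G ⧸ H), b.ι t ≫ End.asHom (ρ g) = b.ι (g • t)) :
    Module.finrank ℤ (⨅ g : G, LinearMap.eqLocus (Preadditive.leftComp Y (End.asHom (ρ g))).toIntLinearMap
        (Preadditive.rightComp b.pt (End.asHom (ρY g))).toIntLinearMap : Submodule ℤ (b.pt ⟶ Y)) =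
      Module.finrank ℤ (⨅ h : H,
        LinearMap.eqLocus (Preadditive.rightComp A (End.asHom (ρY h))).toIntLinearMap LinearMap.id : Submodule ℤ (A ⟶ Y)) := by
  rw [finrank_equivariantHom_permPower_source_eq b ρ ρY ((1 : G) : G ⧸ H) hb hρ, MulAction.stabilizer_quotient H]

/-- **`rk_ℤ Hom_G(X, A^{G/H}) ≤ 4 · dim B_H(X) · dim A`** for the coset power over a finite subgroup `H` (`N_H = Σ_{h ∈ H} ρ'(h)`,
`B_H(X) = Im N_H`). [cite: SerreLinearRepresentations1977, §7.2 Thm. 13] [cite: MumfordAV1970, §19 Cor. 1 (p. 178)]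
[cite: KaniRosen1989, §3 Thm. B] -/
theorem finrank_equivariantHom_cosetPower_target_le_four_mul [Fintype H] (hb : ∑ t, b.π t ≫ b.ι t = 𝟙 b.pt)
    (hρ : ∀ (g : G) (t : G ⧸ H), b.ι t ≫ End.asHom (ρ g) = b.ι (g • t)) {N : X ⟶ X} (hN : End.of N = ∑ h : H, ρ' h) :
    Module.finrank ℤ (⨅ g : G, LinearMap.eqLocus (Preadditive.leftComp b.pt (End.asHom (ρ' g))).toIntLinearMap
        (Preadditive.rightComp X (End.asHom (ρ g))).toIntLinearMap : Submodule ℤ (X ⟶ b.pt)) ≤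
      4 * (image N).dim * A.dim :=
  finrank_equivariantHom_permPower_target_le_four_mul b ρ ρ' ((1 : G) : G ⧸ H) hb hρ (MulAction.stabilizer_quotient H) hN

/-- **`rk_ℤ Hom_G(A^{G/H}, Y) ≤ 4 · dim A · dim B_H(Y)`** for the coset power over a finite subgroup `H` (`N_H = Σ_{h ∈ H} ρ_Y(h)`,
`B_H(Y) = Im N_H`). [cite: SerreLinearRepresentations1977, §7.2 Thm. 13] [cite: MumfordAV1970, §19 Cor. 1 (p. 178)]
[cite: KaniRosen1989, §3 Thm. B] -/
theorem finrank_equivariantHom_cosetPower_source_le_four_mul [Fintype H] (hb : ∑ t, b.π t ≫ b.ι t = 𝟙 b.pt)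
    (hρ : ∀ (g : G) (t : G ⧸ H), b.ι t ≫ End.asHom (ρ g) = b.ι (g • t)) {N : Y ⟶ Y} (hN : End.of N = ∑ h : H, ρY h) :
    Module.finrank ℤ (⨅ g : G, LinearMap.eqLocus (Preadditive.leftComp Y (End.asHom (ρ g))).toIntLinearMap
        (Preadditive.rightComp b.pt (End.asHom (ρY g))).toIntLinearMap : Submodule ℤ (b.pt ⟶ Y)) ≤
      4 * A.dim * (image N).dim :=
  finrank_equivariantHom_permPower_source_le_four_mul b ρ ρY ((1 : G) : G ⧸ H) hb hρ (MulAction.stabilizer_quotient H) hN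

end Coset

end AbelianVariety

end Literature.AlgebraicGeometry.Motives
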